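import Summits.FinalStateConjecture.FinalStateConjecture.Theorems.EIHFluxBalanceInertialRecessionChargeKinematicsStatusPiece
import Summits.FinalStateConjecture.FinalStateConjecture.Theorems.EIHFluxBalanceInertialRecessionChargeKinematicsBreakpoints
import Summits.FinalStateConjecture.FinalStateConjecture.Theorems.EIHFluxBalanceInertialRecessionChargeKinematicsEscapeBudgets

/-!
# Route EIHFluxBalance — `InertialRecession`, line `old-light-leaves-the-cone`: charge kinematics,
# XXVI (general N, mechanism (E) assembled: the anchor's increment via radius rules)

Helper file for the crux `stmt-FinalStateConjecture-10166`
(`Summit.FinalStateConjecture.FinalStateConjecture.Theses.EIHFluxBalance.InertialRecession`), second line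
lead, endgame stub `stub_expandingChargeKinematics` (S4: abstract quasi-conserved window charges with the
slack-form window law and the single-hole identification ⇒ Cesàro velocities of the painted centres).
THE ESCAPE SERIES: the endgame for `N = 3` (Case A all-pairs freezing is `ChargeKinematicsAllPairs*`;
Case B, the escape of a fast hole from a velocity-tight pair, is this series; the assembly is
`ChargeKinematicsThree`).

XXVI — GENERAL N, MECHANISM (E) ASSEMBLED (`anchor_increment_via_rules`): breakpoints from the blocking
functions, constant weak signs between consecutive breakpoints, one status piece each, telescoping; the
count of pieces is polynomial in the number of partners, rules and externals.

Every statement is Mathlib-only real analysis over the stub's verbatim hypotheses ([folklore]); the abstract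
charge `P` is arbitrary (adversarial), constrained only by the window law and the identification.
-/

set_option linter.dupNamespace false

noncomputable section

open Filter Set Metric Real
open scoped Topology

namespace Summit.FinalStateConjecture.FinalStateConjecture.Theorems.ChargeKinematics

open Literature.Geometry.Lorentzian

/-! ## The anchor's increment via rules -/

section ViaRules

open MeasureTheory intervalIntegral

/-- **The anchor's increment over `[t₁, t₂]` via radius rules (mechanism (E) of the general-`N` plan).**
Abstract form: partners `T` (slow distances `d_p ≥ m₀`), certified externals `Y` (rates `g_y`, clearance `≤ c₂s`,
`4·C_n·θ ≤ g_y`), window-law packages for every (rule, member set) on every sub-interval, velocities with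
speeds `≤ k` and internal relative velocities `≤ β'` throughout, errors `≤ ε`. Then
`‖v_a(t₂) − v_a(t₁)‖ ≤ (1 + 4·|T|·(n+1)·|Y|) · [4(C_w B + 3ε)/M_a + 2β']` with the rule budget `B` at `K = C_n`:
the blocking functions `κ·max(m₀,|φ_y|) − C·d_p` have convex negativity sets (`blocking_neg_between`),
hence two breakpoints each (`convex_neg_split`); between consecutive breakpoints every weak sign is
constant and `increment_on_status_piece` applies; the pieces telescope. [folklore] -/
theorem anchor_increment_via_rules {ι κι : Type*} [DecidableEq ι] [DecidableEq κι] (T : Finset ι) (a : ι)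
    (Y : Finset κι) (hY : Y.Nonempty) {n : ℕ} (hn : T.card ≤ n)
    {d : ι → ℝ → ℝ} {φ φ' : κι → ℝ → ℝ} {g : κι → ℝ} {Mc : ι → ℝ} {v : ι → ℝ → E3}
    {Qw : Fin (n + 1) → Finset ι → ℝ → Fin 4 → ℝ} {ew : ℝ → ℝ}
    {Cw k t₁ t₂ m₀ c₂ ε β' θ : ℝ}
    (hk1 : k < 1) (ht₁ : 0 < t₁) (h12 : t₁ ≤ t₂) (hm₀ : 0 < m₀) (hm₀C : 4 * 16 ^ n ≤ m₀) (hc₂ : 0 < c₂)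
    (hct : 1 ≤ c₂ * t₁) (hCw : 0 ≤ Cw) (hε : 0 ≤ ε) (hθ : 0 ≤ θ) (hM : ∀ c ∈ insert a T, 0 < Mc c)
    (haT : a ∉ T)
    (hvk : ∀ c ∈ insert a T, ∀ s ∈ Set.Icc t₁ t₂, ‖v c s‖ ≤ k)
    (hr : ∀ p ∈ T, ∀ s ∈ Set.Icc t₁ t₂, ‖v p s - v a s‖ ≤ β') (hβ' : 0 ≤ β')
    (hdcont : ∀ p ∈ T, Continuous (d p))
    (hdslow : ∀ p ∈ T, ∀ s ∈ Set.Icc t₁ t₂, ∀ s' ∈ Set.Icc t₁ t₂, s ≤ s' → |d p s' - d p s| ≤ 2 * θ * (s' - s))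
    (hdfloor : ∀ p ∈ T, ∀ s ∈ Set.Icc t₁ t₂, m₀ ≤ d p s)
    (hcap : ∀ s ∈ Set.Icc t₁ t₂, (Y.inf' hY fun y ↦ max m₀ |φ y s|) ≤ c₂ * s)
    (hg : ∀ y ∈ Y, 0 < g y) (hrate : ∀ y ∈ Y, 4 * (4 * 16 ^ n) * θ ≤ g y)
    (hφ : ∀ y ∈ Y, ∀ s, HasDerivAt (φ y) (φ' y s) s)
    (hφ' : ∀ y ∈ Y, Continuous (φ' y)) (hmono : ∀ y ∈ Y, ∀ s ∈ Set.Icc t₁ t₂, g y ≤ φ' y s)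
    (hpkg : ∀ (j : Fin (n + 1)) (Ms : Finset ι), Ms ⊆ T → ∀ s₁ s₂, t₁ ≤ s₁ → s₁ ≤ s₂ → s₂ ≤ t₂ →
      (∀ s ∈ Set.Icc s₁ s₂, (∀ p ∈ Ms, 4 * d p s ≤ 2 * ((Y.inf' hY fun y ↦ max m₀ |φ y s|) / (4 * 16 ^ (j : ℕ)))
          ∧ 2 * d p s ≤ c₂ * s) ∧
        (∀ p ∈ T, p ∉ Ms → 2 * ((Y.inf' hY fun y ↦ max m₀ |φ y s|) / (4 * 16 ^ (j : ℕ))) ≤ d p s)) →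
      (∀ μ : Fin 4, |Qw j Ms s₂ μ - Qw j Ms s₁ μ| ≤
        Cw * (∫ s in s₁..s₂, ((min ((Y.inf' hY fun y ↦ max m₀ |φ y s|) / (4 * 16 ^ (j : ℕ))) (c₂ * s)) ^ 2)⁻¹ +
          ((min ((Y.inf' hY fun y ↦ max m₀ |φ y s|) / (4 * 16 ^ (j : ℕ))) (c₂ * s)) ^ (7 / 4 : ℝ))⁻¹) + ew s₁) ∧
      (∀ s, (s = s₁ ∨ s = s₂) → |Qw j Ms s 0 - ∑ c ∈ insert a Ms, Mc c * (√(1 - ‖v c s‖ ^ 2))⁻¹| ≤ ew s ∧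
        ∀ k' : Fin 3, |Qw j Ms s k'.succ - ∑ c ∈ insert a Ms, Mc c * (√(1 - ‖v c s‖ ^ 2))⁻¹ * v c s k'| ≤ ew s))
    (hew : ∀ s ∈ Set.Icc t₁ t₂, ew s ≤ ε) :
    ‖v a t₂ - v a t₁‖ ≤ (1 + 4 * (T.card : ℝ) * (n + 1) * Y.card) *
      (4 * (Cw * (∑ y ∈ Y, (9 * (2 * 2 * (3 * m₀ / (4 * 16 ^ n)) ^ (1 - 2 : ℝ) /
        ((2 - 1) * (3 * g y / (4 * 16 ^ n)))) +
        (3 : ℝ) ^ (7 / 4 : ℝ) * (2 * (7 / 4) * (3 * m₀ / (4 * 16 ^ n)) ^ (1 - 7 / 4 : ℝ) /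
          ((7 / 4 - 1) * (3 * g y / (4 * 16 ^ n)))) +
        ((c₂ ^ 2 * t₁)⁻¹ + 4 / 3 * c₂ ^ (-(7 / 4) : ℝ) * t₁ ^ (-(3 / 4) : ℝ)))) + 3 * ε) / Mc a + 2 * β') := by
  classical
  -- the per-piece bound `X`
  obtain ⟨X, hX⟩ : ∃ x : ℝ, x = 4 * (Cw * (∑ y ∈ Y, (9 * (2 * 2 * (3 * m₀ / (4 * 16 ^ n)) ^ (1 - 2 : ℝ) /
        ((2 - 1) * (3 * g y / (4 * 16 ^ n)))) +
        (3 : ℝ) ^ (7 / 4 : ℝ) * (2 * (7 / 4) * (3 * m₀ / (4 * 16 ^ n)) ^ (1 - 7 / 4 : ℝ) /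
          ((7 / 4 - 1) * (3 * g y / (4 * 16 ^ n)))) +
        ((c₂ ^ 2 * t₁)⁻¹ + 4 / 3 * c₂ ^ (-(7 / 4) : ℝ) * t₁ ^ (-(3 / 4) : ℝ)))) + 3 * ε) / Mc a + 2 * β' :=
    ⟨_, rfl⟩
  rw [← hX]
  have hMapos : 0 < Mc a := hM a (Finset.mem_insert_self a T)
  have hKn : (0 : ℝ) < 4 * 16 ^ n := by positivity
  have hsumnn : ∀ t, 0 < t → 0 ≤ ∑ y ∈ Y, (9 * (2 * 2 * (3 * m₀ / (4 * 16 ^ n)) ^ (1 - 2 : ℝ) /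
      ((2 - 1) * (3 * g y / (4 * 16 ^ n)))) +
      (3 : ℝ) ^ (7 / 4 : ℝ) * (2 * (7 / 4) * (3 * m₀ / (4 * 16 ^ n)) ^ (1 - 7 / 4 : ℝ) /
        ((7 / 4 - 1) * (3 * g y / (4 * 16 ^ n)))) +
      ((c₂ ^ 2 * t)⁻¹ + 4 / 3 * c₂ ^ (-(7 / 4) : ℝ) * t ^ (-(3 / 4) : ℝ))) := fun t ht ↦
    Finset.sum_nonneg fun y hy ↦ by have := hg y hy; positivity
  have hXnn : 0 ≤ X := by
    rw [hX]
    have := hsumnn t₁ ht₁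
    positivity
  -- growth of the external coordinates
  have hφgrow : ∀ y ∈ Y, ∀ s ∈ Set.Icc t₁ t₂, ∀ s' ∈ Set.Icc t₁ t₂, s ≤ s' →
      g y * (s' - s) ≤ φ y s' - φ y s := by
    intro y hy s hs s' hs' hss'
    have hφc : Continuous (φ y) := continuous_iff_continuousAt.mpr fun s ↦ (hφ y hy s).continuousAt
    have hconv : Convex ℝ (Set.Icc t₁ t₂) := convex_Icc t₁ t₂
    have hdiff' : DifferentiableOn ℝ (φ y) (interior (Set.Icc t₁ t₂)) := fun x _ ↦
      (hφ y hy x).differentiableAt.differentiableWithinAt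
    have hge : ∀ x ∈ interior (Set.Icc t₁ t₂), g y ≤ deriv (φ y) x := by
      intro x hx
      rw [interior_Icc] at hx
      rw [(hφ y hy x).deriv]
      exact hmono y hy x ⟨hx.1.le, hx.2.le⟩
    exact hconv.mul_sub_le_image_sub_of_le_deriv hφc.continuousOn hdiff' hge s hs s' hs' hss'
  -- the blocking functions, indexed by `q = (p, j, y, b)`
  set Q : Finset (ι × Fin (n + 1) × κι × Bool) := T ×ˢ (Finset.univ ×ˢ (Y ×ˢ Finset.univ)) with hQdef
  have hQmem : ∀ q ∈ Q, q.1 ∈ T ∧ q.2.2.1 ∈ Y := fun q hq ↦ by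
    simp only [hQdef, Finset.mem_product, Finset.mem_univ, true_and, and_true] at hq
    exact ⟨hq.1, hq.2⟩
  obtain ⟨κf, hκf⟩ : ∃ f : Bool → ℝ, ∀ b, f b = if b then 1 else 2 := ⟨_, fun b ↦ rfl⟩
  obtain ⟨Cf, hCf⟩ : ∃ f : Fin (n + 1) → Bool → ℝ,
      ∀ j b, f j b = if b then 2 * (4 * 16 ^ (j : ℕ)) else 4 * 16 ^ (j : ℕ) := ⟨_, fun j b ↦ rfl⟩
  obtain ⟨Bf, hBf⟩ : ∃ f : (ι × Fin (n + 1) × κι × Bool) → ℝ → ℝ,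
      ∀ q s, f q s = κf q.2.2.2 * max m₀ |φ q.2.2.1 s| - Cf q.2.1 q.2.2.2 * d q.1 s := ⟨_, fun q s ↦ rfl⟩
  have hBc : ∀ q ∈ Q, Continuous (Bf q) := by
    intro q hq
    obtain ⟨hp, hy⟩ := hQmem q hq
    have hφc : Continuous (φ q.2.2.1) :=
      continuous_iff_continuousAt.mpr fun s ↦ (hφ q.2.2.1 hy s).continuousAt
    have : Bf q = fun s ↦ κf q.2.2.2 * max m₀ |φ q.2.2.1 s| - Cf q.2.1 q.2.2.2 * d q.1 s := funext (hBf q)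
    rw [this]
    exact (continuous_const.mul (continuous_const.max hφc.abs)).sub (continuous_const.mul (hdcont q.1 hp))
  have hκpos : ∀ b, 0 < κf b := fun b ↦ by
    cases b
    · rw [hκf]; simp only [Bool.false_eq_true, if_false]; norm_num
    · rw [hκf]; simp only [if_true]; norm_num
  have hκltC : ∀ (j : Fin (n + 1)) b, κf b < Cf j b := fun j b ↦ by
    have h16 : (1 : ℝ) ≤ 16 ^ (j : ℕ) := one_le_pow₀ (by norm_num)
    cases b
    · rw [hκf, hCf]; simp only [Bool.false_eq_true, if_false]; linarith
    · rw [hκf, hCf]; simp only [if_true]; linarith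
  have hκrate : ∀ (j : Fin (n + 1)) b, ∀ y ∈ Y, 2 * Cf j b * θ ≤ κf b * g y := by
    intro j b y hy
    have h16 : (16 : ℝ) ^ (j : ℕ) ≤ 16 ^ n := pow_le_pow_right₀ (by norm_num) (Nat.lt_succ_iff.mp j.2)
    have h16pos : (0 : ℝ) < 16 ^ (j : ℕ) := by positivity
    have hr' := hrate y hy
    have hgy := hg y hy
    have hθ16 : 16 ^ (j : ℕ) * θ ≤ 16 ^ n * θ := mul_le_mul_of_nonneg_right h16 hθ
    cases b
    · rw [hκf, hCf]; simp only [Bool.false_eq_true, if_false]; nlinarith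
    · rw [hκf, hCf]; simp only [if_true]; nlinarith
  have hconv : ∀ q ∈ Q, ∀ s₁ ∈ Set.Icc t₁ t₂, ∀ s₂ ∈ Set.Icc t₁ t₂, ∀ s₃ ∈ Set.Icc t₁ t₂,
      s₁ ≤ s₂ → s₂ ≤ s₃ → Bf q s₁ < 0 → Bf q s₃ < 0 → Bf q s₂ < 0 := by
    intro q hq s₁ hs₁ s₂ hs₂ s₃ hs₃ h12' h23 hB₁ hB₃
    obtain ⟨hp, hy⟩ := hQmem q hq
    rw [hBf] at hB₁ hB₃ ⊢
    exact blocking_neg_between (hg _ hy) (hκpos _) (hκltC q.2.1 _) (hκrate q.2.1 _ _ hy) hm₀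
      (hφgrow _ hy) (hdslow _ hp) (hdfloor _ hp) hs₁ hs₂ hs₃ h12' h23 hB₁ hB₃
  -- two breakpoints per blocking function
  have hsplit : ∀ q, ∃ σm σp : ℝ, q ∈ Q → (t₁ ≤ σm ∧ σm ≤ σp ∧ σp ≤ t₂ ∧
      (∀ s, t₁ ≤ s → s < σm → 0 ≤ Bf q s) ∧ (∀ s, σm < s → s < σp → Bf q s ≤ 0) ∧
      (∀ s, σp < s → s ≤ t₂ → 0 ≤ Bf q s)) := by
    intro q
    by_cases hq : q ∈ Q
    · obtain ⟨σm, σp, h1, h2, h3, hL, hMid, hR⟩ := convex_neg_split h12 (hBc q hq) (hconv q hq)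
      refine ⟨σm, σp, fun _ ↦ ⟨h1, h2, h3, ?_, ?_, ?_⟩⟩
      · intro s hs hsσ
        rcases hL with h | h
        · exact absurd (h ▸ hsσ : s < t₁) (not_lt.mpr hs)
        · exact h s ⟨hs, hsσ.le⟩
      · intro s h1' h2'
        rcases hMid with h | h
        · exact absurd (h ▸ h2' : s < σm) (not_lt.mpr h1'.le)
        · exact h s ⟨h1'.le, h2'.le⟩
      · intro s h1' h2'
        rcases hR with h | h
        · exact absurd (h ▸ h1' : t₂ < s) (not_lt.mpr h2')
        · exact h s ⟨h1'.le, h2'⟩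
    · exact ⟨t₁, t₁, fun h ↦ (hq h).elim⟩
  choose σm σp hσ using hsplit
  -- the breakpoints and their enumeration
  set Bk : Finset ℝ := insert t₁ (insert t₂ (Q.image σm ∪ Q.image σp)) with hBkdef
  have hBk : ∀ b ∈ Bk, t₁ ≤ b ∧ b ≤ t₂ := by
    intro b hb
    simp only [hBkdef, Finset.mem_insert, Finset.mem_union, Finset.mem_image] at hb
    rcases hb with rfl | rfl | ⟨q, hq, rfl⟩ | ⟨q, hq, rfl⟩
    · exact ⟨le_rfl, h12⟩
    · exact ⟨h12, le_rfl⟩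
    · obtain ⟨h1, h2, h3, -⟩ := hσ q hq; exact ⟨h1, h2.trans h3⟩
    · obtain ⟨h1, h2, h3, -⟩ := hσ q hq; exact ⟨h1.trans h2, h3⟩
  have hσmB : ∀ q ∈ Q, σm q ∈ Bk := fun q hq ↦ by
    simp only [hBkdef, Finset.mem_insert, Finset.mem_union, Finset.mem_image]
    exact Or.inr (Or.inr (Or.inl ⟨q, hq, rfl⟩))
  have hσpB : ∀ q ∈ Q, σp q ∈ Bk := fun q hq ↦ by
    simp only [hBkdef, Finset.mem_insert, Finset.mem_union, Finset.mem_image]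
    exact Or.inr (Or.inr (Or.inr ⟨q, hq, rfl⟩))
  obtain ⟨np, σ, hcardσ, hσ0, hσn, hmonoσ, hmemσ, -, htri⟩ :=
    exists_breakpoint_enumeration Bk (Finset.mem_insert_self _ _)
      (Finset.mem_insert_of_mem (Finset.mem_insert_self _ _)) hBk
  have hσI : ∀ i, i ≤ np → σ i ∈ Set.Icc t₁ t₂ := fun i hi ↦ hBk _ (hmemσ i hi)
  -- the bound on one piece
  have hpiece : ∀ i, i < np → ‖v a (σ (i + 1)) - v a (σ i)‖ ≤ X := by
    intro i hi
    have hIi := hσI i hi.le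
    have hIi1 := hσI (i + 1) hi
    rcases eq_or_lt_of_le (hmonoσ i hi) with heq | hlt
    · rw [← heq, sub_self, norm_zero]; exact hXnn
    have hsub : Set.Icc (σ i) (σ (i + 1)) ⊆ Set.Icc t₁ t₂ := Set.Icc_subset_Icc hIi.1 hIi1.2
    -- constant weak signs on the piece
    have hsign : ∀ q ∈ Q, (∀ s ∈ Set.Icc (σ i) (σ (i + 1)), 0 ≤ Bf q s) ∨
        (∀ s ∈ Set.Icc (σ i) (σ (i + 1)), Bf q s ≤ 0) := by
      intro q hq
      obtain ⟨-, -, -, hL, hMid, hR⟩ := hσ q hq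
      rcases htri i hi (σm q) (hσmB q hq) (σp q) (hσpB q hq) with ⟨h1, h2⟩ | h | h
      · right
        intro s hs
        have hneg := nonneg_on_Icc_of_Ioo (f := fun s ↦ -Bf q s) (hBc q hq).neg hlt
          (fun s h1' h2' ↦ neg_nonneg.mpr (hMid s (h1.trans_lt h1') (h2'.trans_le h2))) s hs
        simpa using hneg
      · left
        exact nonneg_on_Icc_of_Ioo (hBc q hq) hlt fun s h1' h2' ↦
          hL s (hIi.1.trans h1'.le) (h2'.trans_le h)
      · left
        exact nonneg_on_Icc_of_Ioo (hBc q hq) hlt fun s h1' h2' ↦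
          hR s (h.trans_lt h1') (h2'.le.trans hIi1.2)
    have hsign₁ : ∀ p ∈ T, ∀ j : Fin (n + 1), ∀ y ∈ Y,
        (∀ s ∈ Set.Icc (σ i) (σ (i + 1)), 0 ≤ max m₀ |φ y s| - 2 * (4 * 16 ^ (j : ℕ)) * d p s) ∨
        (∀ s ∈ Set.Icc (σ i) (σ (i + 1)), max m₀ |φ y s| - 2 * (4 * 16 ^ (j : ℕ)) * d p s ≤ 0) := by
      intro p hp j y hy
      have hq : (p, j, y, true) ∈ Q := by
        simp only [hQdef, Finset.mem_product, Finset.mem_univ, true_and, and_true]; exact ⟨hp, hy⟩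
      have hform : ∀ s, Bf (p, j, y, true) s = max m₀ |φ y s| - 2 * (4 * 16 ^ (j : ℕ)) * d p s := by
        intro s; rw [hBf, hκf, hCf]; simp
      rcases hsign _ hq with h | h
      · exact Or.inl fun s hs ↦ by rw [← hform]; exact h s hs
      · exact Or.inr fun s hs ↦ by rw [← hform]; exact h s hs
    have hsign₂ : ∀ p ∈ T, ∀ j : Fin (n + 1), ∀ y ∈ Y,
        (∀ s ∈ Set.Icc (σ i) (σ (i + 1)), 0 ≤ 2 * max m₀ |φ y s| - (4 * 16 ^ (j : ℕ)) * d p s) ∨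
        (∀ s ∈ Set.Icc (σ i) (σ (i + 1)), 2 * max m₀ |φ y s| - (4 * 16 ^ (j : ℕ)) * d p s ≤ 0) := by
      intro p hp j y hy
      have hq : (p, j, y, false) ∈ Q := by
        simp only [hQdef, Finset.mem_product, Finset.mem_univ, true_and, and_true]; exact ⟨hp, hy⟩
      have hform : ∀ s, Bf (p, j, y, false) s = 2 * max m₀ |φ y s| - (4 * 16 ^ (j : ℕ)) * d p s := by
        intro s; rw [hBf, hκf, hCf]; simp
      rcases hsign _ hq with h | h
      · exact Or.inl fun s hs ↦ by rw [← hform]; exact h s hs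
      · exact Or.inr fun s hs ↦ by rw [← hform]; exact h s hs
    have hct' : 1 ≤ c₂ * σ i := hct.trans (by nlinarith [hIi.1])
    have h := increment_on_status_piece T a Y hY hn hk1 (ht₁.trans_le hIi.1) hlt hm₀ hm₀C hc₂ hct' hCw hM haT
      (fun c hc ↦ ⟨hvk c hc _ hIi, hvk c hc _ hIi1⟩) (fun p hp ↦ ⟨hr p hp _ hIi, hr p hp _ hIi1⟩) hβ'
      (fun s hs ↦ hcap s (hsub hs)) hg hφ hφ' (fun y hy s hs ↦ hmono y hy s (hsub hs))
      hsign₁ hsign₂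
      (fun j Ms hMs s₁ s₂ h1 h12' h2 ↦ hpkg j Ms hMs s₁ s₂ (hIi.1.trans h1) h12' (h2.trans hIi1.2))
      ⟨hew _ hIi, hew _ hIi1⟩
    refine h.trans ?_
    -- compare with `X`: tails at `σ i ≥ t₁`
    rw [hX]
    have htail := budget_tail_antitone hc₂ ht₁ hIi.1
    have hsumle : ∑ y ∈ Y, (9 * (2 * 2 * (3 * m₀ / (4 * 16 ^ n)) ^ (1 - 2 : ℝ) /
        ((2 - 1) * (3 * g y / (4 * 16 ^ n)))) +
        (3 : ℝ) ^ (7 / 4 : ℝ) * (2 * (7 / 4) * (3 * m₀ / (4 * 16 ^ n)) ^ (1 - 7 / 4 : ℝ) /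
          ((7 / 4 - 1) * (3 * g y / (4 * 16 ^ n)))) +
        ((c₂ ^ 2 * σ i)⁻¹ + 4 / 3 * c₂ ^ (-(7 / 4) : ℝ) * σ i ^ (-(3 / 4) : ℝ))) ≤
        ∑ y ∈ Y, (9 * (2 * 2 * (3 * m₀ / (4 * 16 ^ n)) ^ (1 - 2 : ℝ) /
        ((2 - 1) * (3 * g y / (4 * 16 ^ n)))) +
        (3 : ℝ) ^ (7 / 4 : ℝ) * (2 * (7 / 4) * (3 * m₀ / (4 * 16 ^ n)) ^ (1 - 7 / 4 : ℝ) /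
          ((7 / 4 - 1) * (3 * g y / (4 * 16 ^ n)))) +
        ((c₂ ^ 2 * t₁)⁻¹ + 4 / 3 * c₂ ^ (-(7 / 4) : ℝ) * t₁ ^ (-(3 / 4) : ℝ))) :=
      Finset.sum_le_sum fun y _ ↦ by linarith
    have hnum := mul_le_mul_of_nonneg_left hsumle hCw
    have hfrac : 4 * (Cw * (∑ y ∈ Y, (9 * (2 * 2 * (3 * m₀ / (4 * 16 ^ n)) ^ (1 - 2 : ℝ) /
        ((2 - 1) * (3 * g y / (4 * 16 ^ n)))) +
        (3 : ℝ) ^ (7 / 4 : ℝ) * (2 * (7 / 4) * (3 * m₀ / (4 * 16 ^ n)) ^ (1 - 7 / 4 : ℝ) /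
          ((7 / 4 - 1) * (3 * g y / (4 * 16 ^ n)))) +
        ((c₂ ^ 2 * σ i)⁻¹ + 4 / 3 * c₂ ^ (-(7 / 4) : ℝ) * σ i ^ (-(3 / 4) : ℝ)))) + 3 * ε) / Mc a ≤
        4 * (Cw * (∑ y ∈ Y, (9 * (2 * 2 * (3 * m₀ / (4 * 16 ^ n)) ^ (1 - 2 : ℝ) /
        ((2 - 1) * (3 * g y / (4 * 16 ^ n)))) +
        (3 : ℝ) ^ (7 / 4 : ℝ) * (2 * (7 / 4) * (3 * m₀ / (4 * 16 ^ n)) ^ (1 - 7 / 4 : ℝ) /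
          ((7 / 4 - 1) * (3 * g y / (4 * 16 ^ n)))) +
        ((c₂ ^ 2 * t₁)⁻¹ + 4 / 3 * c₂ ^ (-(7 / 4) : ℝ) * t₁ ^ (-(3 / 4) : ℝ)))) + 3 * ε) / Mc a :=
      div_le_div_of_nonneg_right (by linarith) hMapos.le
    linarith
  -- telescope over the pieces and count them
  have htel := norm_sub_le_sum_pieces (v a) σ (n := np)
  rw [hσn, hσ0] at htel
  have hcount : (np : ℝ) ≤ 1 + 4 * (T.card : ℝ) * (n + 1) * Y.card := by
    have hQcard : Q.card = T.card * ((n + 1) * (Y.card * 2)) := by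
      simp only [hQdef, Finset.card_product, Finset.card_univ, Fintype.card_fin, Fintype.card_bool]
    have h1 : Bk.card ≤ 2 + 2 * Q.card := by
      calc Bk.card ≤ (insert t₂ (Q.image σm ∪ Q.image σp)).card + 1 := Finset.card_insert_le _ _
        _ ≤ ((Q.image σm ∪ Q.image σp).card + 1) + 1 := by
            have := Finset.card_insert_le t₂ (Q.image σm ∪ Q.image σp); omega
        _ ≤ ((Q.image σm).card + (Q.image σp).card + 1) + 1 := by
            have := Finset.card_union_le (Q.image σm) (Q.image σp); omega
        _ ≤ (Q.card + Q.card + 1) + 1 := by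
            have h1 := Finset.card_image_le (s := Q) (f := σm)
            have h2 := Finset.card_image_le (s := Q) (f := σp)
            omega
        _ = 2 + 2 * Q.card := by ring
    have h2 : np + 1 ≤ 2 + 2 * (T.card * ((n + 1) * (Y.card * 2))) := by rw [← hQcard, hcardσ]; exact h1
    have h3 : (np : ℝ) + 1 ≤ 2 + 2 * ((T.card : ℝ) * ((n + 1) * ((Y.card : ℝ) * 2))) := by exact_mod_cast h2
    linarith
  calc ‖v a t₂ - v a t₁‖ ≤ ∑ i ∈ Finset.range np, ‖v a (σ (i + 1)) - v a (σ i)‖ := htel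
    _ ≤ ∑ _i ∈ Finset.range np, X := Finset.sum_le_sum fun i hi ↦ hpiece i (Finset.mem_range.mp hi)
    _ = np * X := by rw [Finset.sum_const, Finset.card_range, nsmul_eq_mul]
    _ ≤ (1 + 4 * (T.card : ℝ) * (n + 1) * Y.card) * X := mul_le_mul_of_nonneg_right hcount hXnn

end ViaRules

end Summit.FinalStateConjecture.FinalStateConjecture.Theorems.ChargeKinematics

namespace Summit.FinalStateConjecture.FinalStateConjecture.Theorems

/-- REGISTERED STUB `anchor_increment_via_rules` of the crux item stmt-FinalStateConjecture-10166 (second line lead, line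
`old-light-leaves-the-cone`, S4): the registered signature verbatim, by `ChargeKinematics.anchor_increment_via_rules`. [folklore] -/
theorem anchor_increment_via_rules : open Literature.Geometry.Lorentzian Filter Topology MeasureTheory intervalIntegral in ∀ {ι κι : Type*} [DecidableEq ι] [DecidableEq κι] (T : Finset ι) (a : ι) (Y : Finset κι) (hY : Y.Nonempty) {n : ℕ} (hn : T.card ≤ n) {d : ι → ℝ → ℝ} {φ φ' : κι → ℝ → ℝ} {g : κι → ℝ} {Mc : ι → ℝ} {v : ι → ℝ → E3} {Qw : Fin (n + 1) → Finset ι → ℝ → Fin 4 → ℝ} {ew : ℝ → ℝ} {Cw k t₁ t₂ m₀ c₂ ε β' θ : ℝ} (hk1 : k < 1) (ht₁ : 0 < t₁) (h12 : t₁ ≤ t₂) (hm₀ : 0 < m₀) (hm₀C : 4 * 16 ^ n ≤ m₀) (hc₂ : 0 < c₂) (hct : 1 ≤ c₂ * t₁) (hCw : 0 ≤ Cw) (hε : 0 ≤ ε) (hθ : 0 ≤ θ) (hM : ∀ c ∈ insert a T, 0 < Mc c) (haT : a ∉ T) (hvk : ∀ c ∈ insert a T, ∀ s ∈ Set.Icc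 t₁ t₂, ‖v c s‖ ≤ k) (hr : ∀ p ∈ T, ∀ s ∈ Set.Icc t₁ t₂, ‖v p s - v a s‖ ≤ β') (hβ' : 0 ≤ β') (hdcont : ∀ p ∈ T, Continuous (d p)) (hdslow : ∀ p ∈ T, ∀ s ∈ Set.Icc t₁ t₂, ∀ s' ∈ Set.Icc t₁ t₂, s ≤ s' → |d p s' - d p s| ≤ 2 * θ * (s' - s)) (hdfloor : ∀ p ∈ T, ∀ s ∈ Set.Icc t₁ t₂, m₀ ≤ d p s) (hcap : ∀ s ∈ Set.Icc t₁ t₂, (Y.inf' hY fun y ↦ max m₀ |φ y s|) ≤ c₂ * s) (hg : ∀ y ∈ Y, 0 < g y) (hrate : ∀ y ∈ Y, 4 * (4 * 16 ^ n) * θ ≤ g y) (hφ : ∀ y ∈ Y, ∀ s, HasDerivAt (φ y) (φ' y s) s) (hφ' : ∀ y ∈ Y, Continuous (φ' y)) (hmono : ∀ y ∈ Y, ∀ s ∈ Set.Icc t₁ t₂, g y ≤ φ' y s) (hpkg : ∀ (j : Fin (n + 1)) (Ms : Finset ι), Ms ⊆ T → ∀ s₁ s₂, t₁ ≤ s₁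 → s₁ ≤ s₂ → s₂ ≤ t₂ → (∀ s ∈ Set.Icc s₁ s₂, (∀ p ∈ Ms, 4 * d p s ≤ 2 * ((Y.inf' hY fun y ↦ max m₀ |φ y s|) / (4 * 16 ^ (j : ℕ))) ∧ 2 * d p s ≤ c₂ * s) ∧ (∀ p ∈ T, p ∉ Ms → 2 * ((Y.inf' hY fun y ↦ max m₀ |φ y s|) / (4 * 16 ^ (j : ℕ))) ≤ d p s)) → (∀ μ : Fin 4, |Qw j Ms s₂ μ - Qw j Ms s₁ μ| ≤ Cw * (∫ s in s₁..s₂, ((min ((Y.inf' hY fun y ↦ max m₀ |φ y s|) / (4 * 16 ^ (j : ℕ))) (c₂ * s)) ^ 2)⁻¹ + ((min ((Y.inf' hY fun y ↦ max m₀ |φ y s|) / (4 * 16 ^ (j : ℕ))) (c₂ * s)) ^ (7 / 4 : ℝ))⁻¹) + ew s₁) ∧ (∀ s, (s = s₁ ∨ s = s₂) → |Qw j Ms s 0 - ∑ c ∈ insert a Ms, Mc c * (√(1 - ‖v c s‖ ^ 2))⁻¹| ≤ ew s ∧ ∀ k' : Fin 3, |Qw j Ms s k'.succ - ∑ c ∈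 insert a Ms, Mc c * (√(1 - ‖v c s‖ ^ 2))⁻¹ * v c s k'| ≤ ew s)) (hew : ∀ s ∈ Set.Icc t₁ t₂, ew s ≤ ε), ‖v a t₂ - v a t₁‖ ≤ (1 + 4 * (T.card : ℝ) * (n + 1) * Y.card) * (4 * (Cw * (∑ y ∈ Y, (9 * (2 * 2 * (3 * m₀ / (4 * 16 ^ n)) ^ (1 - 2 : ℝ) / ((2 - 1) * (3 * g y / (4 * 16 ^ n)))) + (3 : ℝ) ^ (7 / 4 : ℝ) * (2 * (7 / 4) * (3 * m₀ / (4 * 16 ^ n)) ^ (1 - 7 / 4 : ℝ) / ((7 / 4 - 1) * (3 * g y / (4 * 16 ^ n)))) + ((c₂ ^ 2 * t₁)⁻¹ + 4 / 3 * c₂ ^ (-(7 / 4) : ℝ) * t₁ ^ (-(3 / 4) : ℝ)))) + 3 * ε) / Mc a + 2 * β') :=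
  @ChargeKinematics.anchor_increment_via_rules

end Summit.FinalStateConjecture.FinalStateConjecture.Theorems

end
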